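import Mathlib
import HarnessLib

/-!
# `NoHeavyLowerTail` (crux stmt-CriticalPhenomena-4575), antithetic vdBHK programme: the COLOURING DICTIONARY of the zone extension —
# `Ω_{Q + v + t}` (a new atom `v` and a new top `t > D ∪ {v}`) IS the sheet poset `T_Z(Ω_Q)` of `AntitheticZonePoset`

Support file (seat `prim-ineq-gen-7` gen 57; `--supports stmt-CriticalPhenomena-4575`).  No `sorry`, no definitions.  Memo:
run/shared/lean/prim/prim-ineq-gen-7/FINDING-NEST-g57.md §2.  Companions: `AntitheticZonePoset` (the abstract sheet poset and its up-set dictionary),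
`AntitheticZoneTransfer` (ZR ∧ AK ⟹ AK of the sheet poset).  With this file the rule 'TOP1 certified by ZR' of the memo is kernel-complete modulo the exact
ZR censuses (and for `D = {a}` an atom it is the colouring dictionary of the WEDGE GLUING of g51, which had only been machine-checked).

SETTING (hypothesis style of `AntitheticHat` / `AntitheticTwin`).  `E` is the ground set of a finite poset `Q` with strict down-sets `down e`, `D ⊆ E` a
down-set (`hD`).  The poset `Q + v + t` lives on `Option (Option E)`: `t = none` (the new top), `v = some none` (the new atom), `e ↦ some (some e)`; its strict
down-sets `downZ` are `↓°e` unchanged (`hZe`), `↓°v = ∅` (`hZv`), `↓°t = {v} ∪ D` (`hZt`).  `leT`, `leZ` are the explicit three-condition colouring orders of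
`Q` and of `Q + v + t` (red interiors shrink, blue interiors grow, a red → blue flip is interior on both sides; `true` = red).  ZONE: `s ∈ Z` iff `D` is red in
`s`, `s ∈ U` iff `D` is blue in `s`.
* `AntitheticZoneColouring.le_iff_zone` — `leZ τ τ′` iff `leT` holds for the restrictions AND the three conditions hold at `v` and at `t` (spelled out: `v` can
  only turn red → blue; `t` is red-interior iff `t, v` red and `s ∈ Z`, blue-interior iff `t, v` blue and `s ∈ U`).
* `AntitheticZoneColouring.sheet_iff` — the conditions at `v` and `t` are EQUIVALENT to the SHEET RULE of `AntitheticZonePoset` (sheets `(vR,tB), (vR,tR),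
  (vB,tB), (vB,tR)`: same sheet; `0→2, 1→3, 0→3` always; `2→3` iff `s ∉ U`; `0→1` iff `s′ ∉ Z`; `1→2` iff `s ∈ Z ∧ s′ ∈ U`), given the monotonicity
  `s′ ∈ Z → s ∈ Z`, `s ∈ U → s′ ∈ U` (consequences of `leT s s′` for a down-set `D`, `zone_mono`) — 16 colour cases, `tauto`.
* `AntitheticZoneColouring.zone_mono` — `leT s s′ ⟹ (s′ ∈ Z → s ∈ Z) ∧ (s ∈ U → s′ ∈ U)` for a down-set `D`.
* `AntitheticZoneColouring.le_iff_sheet` — the three combined: `leZ τ τ′ ⟺ leT s s′ ∧ (sheet rule)` — `Ω_{Q+v+t} = T_Z(Ω_Q)` relation by relation.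
-/

namespace Summit.CriticalPhenomena.PercolationContinuityZ3.Theorems

open Finset

namespace AntitheticZoneColouring

variable {E : Type*}

/-- Bounded quantifier over `↓°e` inside `Q + v + t` (unchanged down-sets of old elements). [this work] -/
theorem forall_downZ_old (down : E → Finset E) (downZ : Option (Option E) → Finset (Option (Option E)))
    (hZe : ∀ e o, o ∈ downZ (some (some e)) ↔ ∃ d ∈ down e, o = some (some d)) (P : Option (Option E) → Prop) (e : E) :
    (∀ o ∈ downZ (some (some e)), P o) ↔ (∀ d ∈ down e, P (some (some d))) := by
  constructor
  · intro h d hd; exact h _ ((hZe e _).2 ⟨d, hd, rfl⟩)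
  · intro h o ho
    obtain ⟨d, hd, rfl⟩ := (hZe e o).1 ho
    exact h d hd

/-- Bounded quantifier over `↓°v = ∅`. [this work] -/
theorem forall_downZ_atom (downZ : Option (Option E) → Finset (Option (Option E))) (hZv : ∀ o, o ∉ downZ (some none))
    (P : Option (Option E) → Prop) : (∀ o ∈ downZ (some none), P o) ↔ True :=
  ⟨fun _ => trivial, fun _ o ho => (hZv o ho).elim⟩

/-- Bounded quantifier over `↓°t = {v} ∪ D`. [this work] -/
theorem forall_downZ_top (D : Finset E) (downZ : Option (Option E) → Finset (Option (Option E)))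
    (hZt : ∀ o, o ∈ downZ none ↔ o = some none ∨ ∃ d ∈ D, o = some (some d)) (P : Option (Option E) → Prop) :
    (∀ o ∈ downZ none, P o) ↔ (P (some none) ∧ ∀ d ∈ D, P (some (some d))) := by
  constructor
  · intro h
    exact ⟨h _ ((hZt _).2 (Or.inl rfl)), fun d hd => h _ ((hZt _).2 (Or.inr ⟨d, hd, rfl⟩))⟩
  · rintro ⟨h1, h2⟩ o ho
    rcases (hZt o).1 ho with rfl | ⟨d, hd, rfl⟩
    · exact h1
    · exact h2 d hd

/-- **ZONE MONOTONICITY.**  Along the colouring order of `Q`, for a down-set `D`: if `D` is red after then it was red before, and if `D` is blue before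
then it is blue after (red interiors shrink, blue interiors grow). [this work] -/
theorem zone_mono (down : E → Finset E) (D : Finset E) (hD : ∀ d ∈ D, ∀ x ∈ down d, x ∈ D)
    (leT : (E → Bool) → (E → Bool) → Prop)
    (hleT : ∀ s t, leT s t ↔
      ((∀ e, (t e = true ∧ ∀ d ∈ down e, t d = true) → (s e = true ∧ ∀ d ∈ down e, s d = true)) ∧
       (∀ e, (s e = false ∧ ∀ d ∈ down e, s d = false) → (t e = false ∧ ∀ d ∈ down e, t d = false)) ∧
       (∀ e, s e = true → t e = false → ((∀ d ∈ down e, s d = true) ∧ (∀ d ∈ down e, t d = false)))))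
    (s s' : E → Bool) (h : leT s s') :
    ((∀ d ∈ D, s' d = true) → (∀ d ∈ D, s d = true)) ∧ ((∀ d ∈ D, s d = false) → (∀ d ∈ D, s' d = false)) := by
  rw [hleT] at h
  obtain ⟨h1, h2, -⟩ := h
  constructor
  · intro hz d hd
    exact (h1 d ⟨hz d hd, fun x hx => hz x (hD d hd x hx)⟩).1
  · intro hu d hd
    exact (h2 d ⟨hu d hd, fun x hx => hu x (hD d hd x hx)⟩).1

/-- **COLOURING DICTIONARY, raw form.**  The colouring order of `Q + v + t` between `τ, τ′` (restrictions `s, s′`, colours `y, y′` of `v` and `ε, ε′`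
of `t`) holds iff the colouring order of `Q` holds between the restrictions, `v` does not turn blue → red, and the three conditions hold at `t` with
`↓°t = {v} ∪ D`. [this work] -/
theorem le_iff_zone (down : E → Finset E) (D : Finset E)
    (downZ : Option (Option E) → Finset (Option (Option E)))
    (hZe : ∀ e o, o ∈ downZ (some (some e)) ↔ ∃ d ∈ down e, o = some (some d))
    (hZv : ∀ o, o ∉ downZ (some none))
    (hZt : ∀ o, o ∈ downZ none ↔ o = some none ∨ ∃ d ∈ D, o = some (some d))
    (leT : (E → Bool) → (E → Bool) → Prop)
    (hleT : ∀ s t, leT s t ↔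
      ((∀ e, (t e = true ∧ ∀ d ∈ down e, t d = true) → (s e = true ∧ ∀ d ∈ down e, s d = true)) ∧
       (∀ e, (s e = false ∧ ∀ d ∈ down e, s d = false) → (t e = false ∧ ∀ d ∈ down e, t d = false)) ∧
       (∀ e, s e = true → t e = false → ((∀ d ∈ down e, s d = true) ∧ (∀ d ∈ down e, t d = false)))))
    (leZ : (Option (Option E) → Bool) → (Option (Option E) → Bool) → Prop)
    (hleZ : ∀ σ ρ, leZ σ ρ ↔
      ((∀ o, (ρ o = true ∧ ∀ d ∈ downZ o, ρ d = true) → (σ o = true ∧ ∀ d ∈ downZ o, σ d = true)) ∧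
       (∀ o, (σ o = false ∧ ∀ d ∈ downZ o, σ d = false) → (ρ o = false ∧ ∀ d ∈ downZ o, ρ d = false)) ∧
       (∀ o, σ o = true → ρ o = false → ((∀ d ∈ downZ o, σ d = true) ∧ (∀ d ∈ downZ o, ρ d = false)))))
    (s s' : E → Bool) (τ τ' : Option (Option E) → Bool)
    (hτ : ∀ e, τ (some (some e)) = s e) (hτ' : ∀ e, τ' (some (some e)) = s' e)
    (y y' ε ε' : Bool) (hy : τ (some none) = y) (hy' : τ' (some none) = y') (hε : τ none = ε) (hε' : τ' none = ε') :
    leZ τ τ' ↔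
      (leT s s' ∧ (y' = true → y = true) ∧
        (((ε' = true ∧ y' = true ∧ ∀ d ∈ D, s' d = true) → (ε = true ∧ y = true ∧ ∀ d ∈ D, s d = true)) ∧
         ((ε = false ∧ y = false ∧ ∀ d ∈ D, s d = false) → (ε' = false ∧ y' = false ∧ ∀ d ∈ D, s' d = false)) ∧
         (ε = true → ε' = false → ((y = true ∧ ∀ d ∈ D, s d = true) ∧ (y' = false ∧ ∀ d ∈ D, s' d = false))))) := by
  have HE := forall_downZ_old down downZ hZe
  have HV := forall_downZ_atom downZ hZv
  have HT := forall_downZ_top D downZ hZt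
  rw [hleZ, hleT]
  constructor
  · rintro ⟨h1, h2, h3⟩
    refine ⟨⟨fun e => ?_, fun e => ?_, fun e => ?_⟩, ?_, ?_, ?_, ?_⟩
    · have h := h1 (some (some e)); simp only [HE, hτ, hτ'] at h; exact h
    · have h := h2 (some (some e)); simp only [HE, hτ, hτ'] at h; exact h
    · have h := h3 (some (some e)); simp only [HE, hτ, hτ'] at h; exact h
    · have h := h1 (some none); simp only [HV, hy, hy', and_true] at h; exact h
    · have h := h1 none; simp only [HT, hτ, hτ', hy, hy', hε, hε'] at h; exact h
    · have h := h2 none; simp only [HT, hτ, hτ', hy, hy', hε, hε'] at h; exact h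
    · have h := h3 none; simp only [HT, hτ, hτ', hy, hy', hε, hε'] at h; exact h
  · rintro ⟨⟨h1e, h2e, h3e⟩, hv, h1t, h2t, h3t⟩
    refine ⟨fun o => ?_, fun o => ?_, fun o => ?_⟩
    · rcases o with _ | _ | e
      · simp only [HT, hτ, hτ', hy, hy', hε, hε']; exact h1t
      · simp only [HV, hy, hy', and_true]; exact hv
      · simp only [HE, hτ, hτ']; exact h1e e
    · rcases o with _ | _ | e
      · simp only [HT, hτ, hτ', hy, hy', hε, hε']; exact h2t
      · simp only [HV, hy, hy', and_true]
        intro hyf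
        cases hy0 : y' with
        | false => rfl
        | true => rw [hv hy0] at hyf; exact absurd hyf (by decide)
      · simp only [HE, hτ, hτ']; exact h2e e
    · rcases o with _ | _ | e
      · simp only [HT, hτ, hτ', hy, hy', hε, hε']; exact h3t
      · simp only [HV, hy, hy', and_self]; intro _ _; trivial
      · simp only [HE, hτ, hτ']; exact h3e e

/-- **SHEET RULE.**  The conditions at `v` and `t` of `le_iff_zone`, with `zD := (D red in s)`, `uD := (D blue in s)` and their primed versions, are
equivalent to the sheet relation of `AntitheticZonePoset` (sheets `0 = (vR,tB)`, `1 = (vR,tR)`, `2 = (vB,tB)`, `3 = (vB,tR)`): same sheet, `0→2`, `1→3`,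
`0→3` always, `2→3` iff `¬uD`, `0→1` iff `¬zD′`, `1→2` iff `zD ∧ uD′` — provided `zD′ → zD`, `uD → uD′` (`zone_mono`; disjointness of `Z` and `U`
is not even needed).  Sixteen colour cases. [this work] -/
theorem sheet_iff (y y' ε ε' : Bool) (zD zD' uD uD' : Prop) (hzz : zD' → zD) (huu : uD → uD') :
    ((y' = true → y = true) ∧
      (((ε' = true ∧ y' = true ∧ zD') → (ε = true ∧ y = true ∧ zD)) ∧
       ((ε = false ∧ y = false ∧ uD) → (ε' = false ∧ y' = false ∧ uD')) ∧
       (ε = true → ε' = false → ((y = true ∧ zD) ∧ (y' = false ∧ uD'))))) ↔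
    ((y = y' ∧ ε = ε') ∨
      (y = true ∧ ε = false ∧ y' = false ∧ ε' = false) ∨
      (y = true ∧ ε = true ∧ y' = false ∧ ε' = true) ∨
      (y = true ∧ ε = false ∧ y' = false ∧ ε' = true) ∨
      (y = false ∧ ε = false ∧ y' = false ∧ ε' = true ∧ ¬ uD) ∨
      (y = true ∧ ε = false ∧ y' = true ∧ ε' = true ∧ ¬ zD') ∨
      (y = true ∧ ε = true ∧ y' = false ∧ ε' = false ∧ zD ∧ uD')) := by
  cases y <;> cases y' <;> cases ε <;> cases ε' <;> simp <;> tauto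

/-- **COLOURING DICTIONARY (sheet form).**  `Ω_{Q+v+t} = T_Z(Ω_Q)`: the colouring order of `Q + v + t` holds between `τ, τ′` iff the colouring order of
`Q` holds between the restrictions `s, s′` AND the pair of sheets `(y,ε) → (y′,ε′)` is allowed by the zone rule of `AntitheticZonePoset` (with `s ∈ Z` ⟺
`D` red in `s`, `s′ ∈ U` ⟺ `D` blue in `s′`).  `D` must be a down-set. [this work] -/
theorem le_iff_sheet (down : E → Finset E) (D : Finset E) (hD : ∀ d ∈ D, ∀ x ∈ down d, x ∈ D)
    (downZ : Option (Option E) → Finset (Option (Option E)))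
    (hZe : ∀ e o, o ∈ downZ (some (some e)) ↔ ∃ d ∈ down e, o = some (some d))
    (hZv : ∀ o, o ∉ downZ (some none))
    (hZt : ∀ o, o ∈ downZ none ↔ o = some none ∨ ∃ d ∈ D, o = some (some d))
    (leT : (E → Bool) → (E → Bool) → Prop)
    (hleT : ∀ s t, leT s t ↔
      ((∀ e, (t e = true ∧ ∀ d ∈ down e, t d = true) → (s e = true ∧ ∀ d ∈ down e, s d = true)) ∧
       (∀ e, (s e = false ∧ ∀ d ∈ down e, s d = false) → (t e = false ∧ ∀ d ∈ down e, t d = false)) ∧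
       (∀ e, s e = true → t e = false → ((∀ d ∈ down e, s d = true) ∧ (∀ d ∈ down e, t d = false)))))
    (leZ : (Option (Option E) → Bool) → (Option (Option E) → Bool) → Prop)
    (hleZ : ∀ σ ρ, leZ σ ρ ↔
      ((∀ o, (ρ o = true ∧ ∀ d ∈ downZ o, ρ d = true) → (σ o = true ∧ ∀ d ∈ downZ o, σ d = true)) ∧
       (∀ o, (σ o = false ∧ ∀ d ∈ downZ o, σ d = false) → (ρ o = false ∧ ∀ d ∈ downZ o, ρ d = false)) ∧
       (∀ o, σ o = true → ρ o = false → ((∀ d ∈ downZ o, σ d = true) ∧ (∀ d ∈ downZ o, ρ d = false)))))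
    (s s' : E → Bool) (τ τ' : Option (Option E) → Bool)
    (hτ : ∀ e, τ (some (some e)) = s e) (hτ' : ∀ e, τ' (some (some e)) = s' e)
    (y y' ε ε' : Bool) (hy : τ (some none) = y) (hy' : τ' (some none) = y') (hε : τ none = ε) (hε' : τ' none = ε') :
    leZ τ τ' ↔
      (leT s s' ∧
        ((y = y' ∧ ε = ε') ∨
          (y = true ∧ ε = false ∧ y' = false ∧ ε' = false) ∨
          (y = true ∧ ε = true ∧ y' = false ∧ ε' = true) ∨
          (y = true ∧ ε = false ∧ y' = false ∧ ε' = true) ∨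
          (y = false ∧ ε = false ∧ y' = false ∧ ε' = true ∧ ¬ (∀ d ∈ D, s d = false)) ∨
          (y = true ∧ ε = false ∧ y' = true ∧ ε' = true ∧ ¬ (∀ d ∈ D, s' d = true)) ∨
          (y = true ∧ ε = true ∧ y' = false ∧ ε' = false ∧ (∀ d ∈ D, s d = true) ∧ (∀ d ∈ D, s' d = false)))) := by
  rw [le_iff_zone down D downZ hZe hZv hZt leT hleT leZ hleZ s s' τ τ' hτ hτ' y y' ε ε' hy hy' hε hε']
  constructor
  · rintro ⟨hle, hv, ht⟩
    have hm := zone_mono down D hD leT hleT s s' hle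
    exact ⟨hle, (sheet_iff y y' ε ε' _ _ _ _ hm.1 hm.2).1 ⟨hv, ht⟩⟩
  · rintro ⟨hle, hsh⟩
    have hm := zone_mono down D hD leT hleT s s' hle
    exact ⟨hle, (sheet_iff y y' ε ε' _ _ _ _ hm.1 hm.2).2 hsh⟩

end AntitheticZoneColouring

end Summit.CriticalPhenomena.PercolationContinuityZ3.Theorems
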